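import Summits.QuantumFields.YangMills.Theorems.FluctuationComparisonRegPrIntLOrganTangentNearStability
import Summits.QuantumFields.YangMills.Theorems.FluctuationComparisonRegPrIntLOrganTangentSmallStepWindowPath
import HarnessLib

/-!
# Crux `FluctuationComparisonRegPrIntL` (stmt-QuantumFields-20520, rung R3), PATH-B organ — «NEAR STABILITY OF THE SQUARE FAMILY FROM ONE-BOND DISPLACEMENT» ((N5); sequel of
# ✓p819195 `…OrganTangentNearDisplacement` ∕ ✓p819252 `…OrganTangentNearStability`; LEAD w3 g27 №1 (2) «TN-ICURV-FAR» ∕ RULING №51 amendment A1 «(I-curv)sq»; DEFINITION-FREE)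

Cell `ym3-torus` (YM ladder rung R3 = continuum `SU(2)` Yang–Mills on the three-torus — a RUNG: NOT d = 4, NOT infinite volume, NOT a mass gap, NOT Clay).
Width seat `ym3-torus-px20` (gen 21); `--kind proof --supports stmt-QuantumFields-20520 --as helper`, count-neutral, no registry ∕ binder ∕ `Lines/` edit, default
heartbeats, `autoImplicit false`.  Over ✓p819195 (one-move forward∕reverse bounds `dist1_chart_update_le` ∕ `dist1_chart_le_rel`, the corner table `dist1_chart_square_corners`),
✓p819252 (`hstab_of_near`), ✓`…OrganTangentSmallStepWindowPath.expPt_add_smul` (the one-parameter subgroup law in cube coordinates), ✓p817898 (`plaqSmall_relPath_of_le`,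
`plaqSmall_relSquare_of_le`) and ✓p818026 (`plaqSmall_mono`, `abs_le_two_of_mem_Icc`).

WHY.  The near-pair amendment A1 of the row-sq (LEAD g27 RULING №51) restricts the (I-curv) clauses `hcurv`∕`hcrude` to a law point `Xw` that is a CORNER of the square being
differentiated.  Whoever DISCHARGES `hcurv`-near must know that, on the law corner's good fibre points `z` (`mwCut (Φ (Xw, z)) ≠ 0`), EVERY point of the one-bond exponential
square family `sq U b m b′ m′ s t = update (update U b (U b·expPt (s•m))) b′ (…·expPt (t•m′))`, `(s,t) ∈ [0,1]²`, is mapped by the chart into the fine window where `h_Ts` is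
regular.  This file proves that this costs EXACTLY the row-sq's room₃ — `k = 3` admissible moves, never 4: from `U` two forward partial moves; from `V = U·e^m@b` ONE move by
`(s−1)•m` (`e^m·e^{(s−1)m} = e^{sm}`, ✓`expPt_add_smul`) then `t•m′`; from `W` and from `Y` three (`W → U`, resp. `Y → V`, first) — so LEAD g27 №1 (2)'s sentence «inside room₃»
is a kernel fact and ✓p819195's generic `plaqSmall_chart_along_square_of_lawCorner` (room `4·`, hub through `U`) is superseded for the family.
* ★`update_partial_eq_update_of_rel` — the partial point `U·e^{sm}@b` IS the one-move `V·e^{(s−1)m}@b` of the corner `V`;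
* ★`dist1_chart_family_corner_le` (generic chart `T`, ✓p816275's `hdisp` binder text, uniform cap): `dist1 (T (sq … s t)) p ≤ dist1 (T Xw) p + 3·(Db·rc)` for every corner `Xw`
  (disjunction of the four equations) and `(s,t) ∈ [0,1]²`, given the corners and the partial point `U·e^{sm}@b` in the coarse `θc′`-window;
* ★★`hstab_family_of_hdisp` (T³ record; the PAIR-LOCAL `hstab` letter with `z` first, as ✓p819252): under the row-sq's (I-geo)sq binders VERBATIM (`hdisp` of «b», cap
  `∀ p b, DP p b ≤ Db`, guard `(1 + 16·√3·rc)·(θ_j∕4) ≤ θ_j`, room₃ `24∕25·θBal_Ts + 3·(Db·rc) ≤ c·θBal_Ts`): `∀ ⟨admissible θ_j∕4-square⟩ (Xw) (hXw : Xw = U ∨ Xw = V ∨ Xw = W ∨ Xw = Y),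
  ∀ s ∈ Icc 0 1, ∀ t ∈ Icc 0 1, ∀ z, mwCut … (Φ (Xw, z)) ≠ 0 → ∀ p, dist1 (plaqHol (Φ (sq U B m B′ m′ s t, z)) p) ≤ c·θBal_Ts`.
INPUT LEFT TO PRINT: the displacement letters `DP` of Bałaban's minimiser-following chart ([Balaban1985Variational] Thm 1 (10) p.279, Prop 9 (190) p.309) — NOT constructed here.

HONEST FRAMING: `dist1`∕`Function.update` bookkeeping over a HYPOTHESIS clause; nothing of Bałaban's analysis is asserted or proved; `SpreadFibreLawH(J)(sq)` ∕ `OrganDischargeInputsHJ(sq)`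
are HYPOTHESIS rows, UNDISCHARGED and exactly as open; LIN″, JEN″, JVARᵘ-H″, O1ᵘ-H v2.2, S1aᴴ, S3ᴴ, S2α′, S2β, 26243, the five registered stubs of `Lines/semiclassical_s2beta.lean`
(registry 3732b7df untouched), crux 20520 `FluctuationComparisonRegPrIntL` and `YM3TorusSU2` are NOT proved; no summit ∕ sub-problem statement is proved; rung R3 = SU(2) YM₃ on T³
at fixed lattice data — NOT d = 4, NOT infinite volume, NOT a mass gap, NOT Clay; the Yang–Mills mass gap is NOT proved.  [folklore]
-/

set_option autoImplicit false

noncomputable section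

namespace Summit.QuantumFields.YangMills.Theorems.OrganTangentNearFamilyStability

open Function Set
open Literature.MathematicalPhysics.QuantumFieldTheory.Balaban1983to89
open T4CubeChartExp (expPt)
open Summit.QuantumFields.YangMills.Theorems.OrganTangentSeedHClause (eq_update_of_rel)
open Summit.QuantumFields.YangMills.Theorems.OrganTangentNearDisplacement
open Summit.QuantumFields.YangMills.Theorems.OrganTangentNearStability (hstab_of_near)
open Summit.QuantumFields.YangMills.Theorems.OrganTangentSmallStepWindowPath (expPt_add_smul)

/-! ## §1 Generic chart: every family point is within three moves of every corner -/

section Generic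

variable {P Q : Params} {j i : ℕ} [DecidableEq (PBond P j)]

omit [DecidableEq (PBond P j)] in
/-- `s ∈ [0,1] ⟹ |s − 1| ≤ 1`. [folklore] -/
theorem abs_sub_one_le_one_of_mem_Icc {s : ℝ} (hs : s ∈ Icc (0 : ℝ) 1) : |s - 1| ≤ 1 := by
  rw [abs_le]; constructor <;> linarith [hs.1, hs.2]

/-- ★ The partial point `U·e^{sm}@b` IS the one-move `V·e^{(s−1)m}@b` of the corner `V = U·e^m@b` (✓`expPt_add_smul`: `e^{sm} = e^m·e^{(s−1)m}`). [folklore] -/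
theorem update_partial_eq_update_of_rel {U V : GaugeField P j (Matrix.specialUnitaryGroup (Fin 2) ℂ)} {b : PBond P j} {m : Fin 3 → ℝ}
    (hVoff : ∀ e, e ≠ b → V e = U e) (hVon : V b = U b * expPt m) (s : ℝ) :
    update U b (U b * expPt (s • m)) = update V b (V b * expPt ((s - 1) • m)) := by
  have h := expPt_add_smul 1 (s - 1) m
  rw [one_smul, show (1 : ℝ) + (s - 1) = s by ring] at h
  rw [eq_update_of_rel hVoff hVon, update_idem, update_self, mul_assoc, ← h]

/-- ★ **EVERY FAMILY POINT IS WITHIN THREE MOVES OF EVERY CORNER** (generic chart; ✓p816275's `hdisp` binder text, uniform cap `Db`): for the admissible square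
`V = U·e^m@b, W = U·e^{m′}@b′, Y = V·e^{m′}@b′` (corners and the partial point `U·e^{sm}@b` in the `θc′`-window) and `(s,t) ∈ [0,1]²`:
`dist1 (T (sq U b m b′ m′ s t)) p ≤ dist1 (T Xw) p + 3·(Db·rc)` for every corner `Xw` (counts `U`: 2, `V`: 2, `W`: 3, `Y`: 3). [folklore] -/
theorem dist1_chart_family_corner_le {θc θc' rc Db : ℝ} (hθc : 0 < θc) (hrc : 0 ≤ rc)
    (T : GaugeField P j (Matrix.specialUnitaryGroup (Fin 2) ℂ) → GaugeField Q i (Matrix.specialUnitaryGroup (Fin 2) ℂ))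
    (DP : Plaq Q i → PBond P j → ℝ)
    (hdisp : ∀ (U : GaugeField P j (Matrix.specialUnitaryGroup (Fin 2) ℂ)), PlaqSmall θc' U →
      ∀ (b : PBond P j) (v : Fin 3 → ℝ), ‖v‖ ≤ rc * θc → ∀ s ∈ Icc (0 : ℝ) 1, ∀ p : Plaq Q i,
        dist1 (GaugeField.plaqHol (T (update U b (U b * expPt (s • v)))) p)
          ≤ dist1 (GaugeField.plaqHol (T U) p) + DP p b * (‖v‖ / θc))
    (hDb0 : 0 ≤ Db) (hDb : ∀ p b, DP p b ≤ Db)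
    {b b' : PBond P j} {m m' : Fin 3 → ℝ} {U V W Y : GaugeField P j (Matrix.specialUnitaryGroup (Fin 2) ℂ)}
    (hm : ‖m‖ ≤ rc * θc) (hm' : ‖m'‖ ≤ rc * θc)
    (hU : PlaqSmall θc' U) (hV : PlaqSmall θc' V) (hW : PlaqSmall θc' W) (hY : PlaqSmall θc' Y)
    (hVoff : ∀ e, e ≠ b → V e = U e) (hVon : V b = U b * expPt m) (hWoff : ∀ e, e ≠ b' → W e = U e) (hWon : W b' = U b' * expPt m')
    (hYoff : ∀ e, e ≠ b' → Y e = V e) (hYon : Y b' = V b' * expPt m')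
    {s t : ℝ} (hs : s ∈ Icc (0 : ℝ) 1) (ht : t ∈ Icc (0 : ℝ) 1)
    (hmid : PlaqSmall θc' (update U b (U b * expPt (s • m))))
    {Xw : GaugeField P j (Matrix.specialUnitaryGroup (Fin 2) ℂ)} (hXw : Xw = U ∨ Xw = V ∨ Xw = W ∨ Xw = Y) (p : Plaq Q i) :
    dist1 (GaugeField.plaqHol (T (update (update U b (U b * expPt (s • m))) b' ((update U b (U b * expPt (s • m))) b' * expPt (t • m')))) p)
      ≤ dist1 (GaugeField.plaqHol (T Xw) p) + 3 * (Db * rc) := by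
  have hD : 0 ≤ Db * rc := mul_nonneg hDb0 hrc
  have hsm : ‖s • m‖ ≤ rc * θc := (norm_smul_le_of_abs_le_one (abs_le_one_of_mem_Icc hs) m).trans hm
  have htm : ‖t • m'‖ ≤ rc * θc := (norm_smul_le_of_abs_le_one (abs_le_one_of_mem_Icc ht) m').trans hm'
  have hs1m : ‖(s - 1) • m‖ ≤ rc * θc := (norm_smul_le_of_abs_le_one (abs_sub_one_le_one_of_mem_Icc hs) m).trans hm
  -- forward partial moves: U → mid → sq
  have h1 := dist1_chart_update_le hθc T DP hdisp hDb0 hDb U hU b (s • m) hsm p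
  have h2 := dist1_chart_update_le hθc T DP hdisp hDb0 hDb _ hmid b' (t • m') htm p
  -- the partial point as ONE move from the corner `V`
  have h3 := dist1_chart_update_le hθc T DP hdisp hDb0 hDb V hV b ((s - 1) • m) hs1m p
  rw [← update_partial_eq_update_of_rel hVoff hVon s] at h3
  -- corner table: `U` from `W`, `V` from `Y`
  obtain ⟨-, ⟨-, hWU⟩, ⟨-, hYV⟩, -, -, -⟩ :=
    dist1_chart_square_corners hθc T DP hdisp hDb0 hDb hm hm' hU hV hW hY hVoff hVon hWoff hWon hYoff hYon p
  rcases hXw with rfl | rfl | rfl | rfl <;> linarith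

end Generic

/-! ## §2 At the T³ record: the PAIR-LOCAL letter for (law corner, family point) from the row-sq's `hdisp` -/

open T3ContinuumYM3Torus T3NestedUnitLaws T3UnitLawDensityEML T4Continuum BalabanUVClass T3UnitScaleTilt T3LevelShift T3TiltDescent
open Summit.QuantumFields.YangMills.Theorems.FluctuationComparisonRegPrIntLRunpairOrganFibreLaw (mwCut)
open Summit.QuantumFields.YangMills.Theorems.OrganTangentILawKnitFacts (plaqSmall_mono abs_le_two_of_mem_Icc)
open Summit.QuantumFields.YangMills.Theorems.OrganTangentRelPathWindow (plaqSmall_relPath_of_le)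
open Summit.QuantumFields.YangMills.Theorems.OrganTangentNearStability (guard8_of_guard16)

/-- ★★ **NEAR STABILITY OF THE SQUARE FAMILY from the row-sq's `hdisp`** (law point `Xw` ANY corner of the admissible `θ_j∕4`-square, value point ANY point of its one-bond
exponential family, `(s,t) ∈ [0,1]²`; ROOM₃ `24∕25·θBal_Ts + 3·(Db·rc) ≤ c·θBal_Ts` — the same room as ✓p819252, no `4·`). [folklore] -/
theorem hstab_family_of_hdisp (F : T3Family) (γ b₀ p₀ : ℝ) (j Ts : ℕ) (hjTs : j + 1 ≤ Ts)
    (hχsupp : ∀ U, mwCut F γ b₀ p₀ j Ts U ≠ 0 → ∀ (n : ℕ) (hjn : j + 1 ≤ n) (hnK : n ≤ Ts), PlaqSmall (24 / 25 * θBal F.L γ b₀ p₀ n) (descendTo F ℰp n Ts hnK U))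
    {Z : Type} (Φ : GaugeField (F.P j) 0 ↥(Matrix.specialUnitaryGroup (Fin 2) ℂ) × Z → GaugeField (F.P Ts) 0 ↥(Matrix.specialUnitaryGroup (Fin 2) ℂ))
    (hθj : 0 < θBal F.L γ b₀ p₀ j) (c Db rc : ℝ) (hrc : 0 ≤ rc) (hDb0 : 0 ≤ Db) (DP : Plaq (F.P Ts) 0 → PBond (F.P j) 0 → ℝ) (hDb : ∀ p b, DP p b ≤ Db)
    (hguard : (1 + 16 * Real.sqrt 3 * rc) * (θBal F.L γ b₀ p₀ j / 4) ≤ θBal F.L γ b₀ p₀ j)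
    (hdisp : ∀ (z : Z) (X : GaugeField (F.P j) 0 ↥(Matrix.specialUnitaryGroup (Fin 2) ℂ)), PlaqSmall (θBal F.L γ b₀ p₀ j) X →
      ∀ (b : PBond (F.P j) 0) (v : Fin 3 → ℝ), ‖v‖ ≤ rc * (θBal F.L γ b₀ p₀ j / 4) → ∀ s ∈ Icc (0 : ℝ) 1, ∀ p : Plaq (F.P Ts) 0,
        dist1 (GaugeField.plaqHol (Φ (update X b (X b * expPt (s • v)), z)) p)
          ≤ dist1 (GaugeField.plaqHol (Φ (X, z)) p) + DP p b * (‖v‖ / (θBal F.L γ b₀ p₀ j / 4)))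
    (hroom : 24 / 25 * θBal F.L γ b₀ p₀ Ts + 3 * (Db * rc) ≤ c * θBal F.L γ b₀ p₀ Ts) :
    ∀ (z : Z) (B B' : PBond (F.P j) 0) (m m' : Fin 3 → ℝ) (U V W Y : GaugeField (F.P j) 0 ↥(Matrix.specialUnitaryGroup (Fin 2) ℂ)),
      ‖m‖ ≤ rc * (θBal F.L γ b₀ p₀ j / 4) → ‖m'‖ ≤ rc * (θBal F.L γ b₀ p₀ j / 4) →
      PlaqSmall (θBal F.L γ b₀ p₀ j / 4) U → PlaqSmall (θBal F.L γ b₀ p₀ j / 4) V → PlaqSmall (θBal F.L γ b₀ p₀ j / 4) W → PlaqSmall (θBal F.L γ b₀ p₀ j / 4) Y →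
      (∀ e, e ≠ B → V e = U e) → V B = U B * expPt m → (∀ e, e ≠ B' → W e = U e) → W B' = U B' * expPt m' →
      (∀ e, e ≠ B' → Y e = V e) → Y B' = V B' * expPt m' →
      ∀ (Xw : GaugeField (F.P j) 0 ↥(Matrix.specialUnitaryGroup (Fin 2) ℂ)), (Xw = U ∨ Xw = V ∨ Xw = W ∨ Xw = Y) →
      ∀ s ∈ Icc (0 : ℝ) 1, ∀ t ∈ Icc (0 : ℝ) 1,
      mwCut F γ b₀ p₀ j Ts (Φ (Xw, z)) ≠ 0 →
      ∀ p, dist1 (GaugeField.plaqHol (Φ (update (update U B (U B * expPt (s • m))) B' ((update U B (U B * expPt (s • m))) B' * expPt (t • m')), z)) p)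
        ≤ c * θBal F.L γ b₀ p₀ Ts := by
  intro z B B' m m' U V W Y hm hm' hU hV hW hY hVoff hVon hWoff hWon hYoff hYon Xw hXw s hs t ht hχ
  have hθ4 : 0 < θBal F.L γ b₀ p₀ j / 4 := by positivity
  have hq : θBal F.L γ b₀ p₀ j / 4 ≤ θBal F.L γ b₀ p₀ j := by linarith
  -- the partial point `U·e^{sm}@B` stays in the `θ_j`-window (relational path from `U`, ✓p817898 + guard)
  have hmid : PlaqSmall (θBal F.L γ b₀ p₀ j) (update U B (U B * expPt (s • m))) := by
    have h := plaqSmall_relPath_of_le (X := fun s => update U B (U B * expPt (s • m))) hU hm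
      (fun s e he => update_of_ne he _ _) (fun s => update_self _ _ _) (abs_le_two_of_mem_Icc hs)
    exact plaqSmall_mono (guard8_of_guard16 hrc hθj.le hguard) h
  have hnear := dist1_chart_family_corner_le hθ4 hrc (fun X => Φ (X, z)) DP (hdisp z) hDb0 hDb hm hm'
    (plaqSmall_mono hq hU) (plaqSmall_mono hq hV) (plaqSmall_mono hq hW) (plaqSmall_mono hq hY) hVoff hVon hWoff hWon hYoff hYon hs ht hmid hXw
  exact hstab_of_near F γ b₀ p₀ j Ts hjTs hχsupp Φ c (3 * (Db * rc)) hroom z _ Xw hnear hχ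

end Summit.QuantumFields.YangMills.Theorems.OrganTangentNearFamilyStability

end
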